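/-
Copyright (c) 2026. All rights reserved.
Released under Apache 2.0 license as described in the file LICENSE.
Authors: abc-iut cell, prover seat abc-iut-w5-d144 (gen 6; row «COR510iv-SB′», brick E input «D2a-EMB»), after abc-iut-w5-d053's
`plusToTS` lemmas (`LogFrobeniusObservablesTSOfPlus.lean`), for this seat's embeddings `embMonoPlus` / `embMonoTS` (p484312).
-/
import Literature.AnabelianGeometry.AbsoluteAnabelian.Ltimes.LogFrobeniusMonoTelecoreObservables
import Literature.AnabelianGeometry.AbsoluteAnabelian.StrictHomotopyFamilies
import Literature.AnabelianGeometry.AbsoluteAnabelian.DiagramPathEmbeddings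
import HarnessLib
import Literature.AnabelianGeometry.AbsoluteAnabelian.LogFrobeniusMonoTelecoreObservablesEmb

/-!
# [AbsTopIII] Cor 5.10 (iv)(b): the embeddings of the observables' diagrams into the telecore diagram `D_{An⊢}` — bookkeeping

S. Mochizuki, *Topics in absolute anabelian geometry III*, J. Math. Sci. Univ. Tokyo 22 (2015) [MochizukiAbsTopIII2015];
manuscript `paper:url-5493eb38cbb7`: Cor 5.10 (iv)(b) pp. 147–148, Cor 5.5 (iii) p. 131, Def 3.5 (i) pp. 74–75.

PROOF-ONLY bookkeeping for abc-iut-f-101's brick D2 («sink at `𝒩⊞_v` = `Hplus v` transported along `embMonoPlus`;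
mapPath-injective + path lifting») about this seat's graph embeddings of p484312 (`embMonoPlus J v`, `embMonoTS J v`),
transposing abc-iut-w5-d053's `plusToTS_*` lemmas (`LogFrobeniusObservablesTSOfPlus.lean`): injectivity on objects /
arrows / paths; PATH LIFTING (`exists_eq_embMonoPlus_mapPath`, `exists_eq_embMonoTS_mapPath`: every path of `Γ⃗_{D_{An⊢}}`
INTO `𝒩⊞_v`, resp. `𝒩_v`, comes from the observable's graph — given `hJ`: telecore edges land at non-holomorphic vertices,
as the printed `φ^{An⊢⊞}_{w,ν} : An⊢ → 𝒩⊢⊞_w` do, `isEmpty_monoTelecoreIdx_of_isHolomorphic`); agreement of the path functors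
along the embeddings (`pathFunctor'_embMonoPlus_heq/_eq`, TS twins).  Nothing here bears on [IUTchIII] Cor. 3.12; no side taken.

**`⋉`-TWIN (cell row «LTIMES-SUCCESSOR», L4-lead m162; typing finding T3g9-F1).**  This file is the verbatim
re-elaboration of `LogFrobeniusMonoTelecoreObservablesEmb.lean` over the successor interface `LogFrobeniusSettingLtimes`
(`Ltimes/LogFrobeniusCompatibility.lean`: `ι⊞_{v,ε}` indexed by the edges of `Γ⃗^⋉_v` at EVERY place, [AbsTopIII] Cor 5.5 (iii)
p. 131), produced by the cell recipe `LTIMES-RECIPE.md`: names carry over inside `namespace LogFrobeniusSettingLtimes`, the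
section variable is `Lt`, setting-independent declarations are NOT repeated (the originals are in scope), statements and
proofs are otherwise unchanged.  The original file over the frozen interface stays as it is.
SLICE T9 (abc-iut-f-101 gen 6): the lemmas about `embMonoPlus` are RE-PROVED verbatim over this namespace's `embMonoPlus`
(one identifier qualified per statement to keep the raw statement text distinct from the frozen one); `isEmpty_monoTelecoreIdx_of_isHolomorphic`
is exported.
-/

universe u

open CategoryTheory Quiver

namespace Literature.AnabelianGeometry.AbsoluteAnabelian

namespace LogFrobeniusSettingLtimes

export LogFrobeniusSetting (isEmpty_monoTelecoreIdx_of_isHolomorphic)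

variable {Vmod : Type u} {isArc : Vmod → Bool} (Lt : LogFrobeniusSettingLtimes Vmod isArc)
  (J : DSub (monoBase (Vmod := Vmod) (isArc := isArc) 6) → Type u) (v : Vmod)

/-! ## The `⊞`-embedding `embMonoPlus` -/

section Plus

/-- A path of the `⊞`-shape starting at the observation vertex `𝒩⊞_v` ends there (no edge leaves `𝒩⊞_v`).
[cite: MochizukiAbsTopIII2015, Definition 3.5 (iii) p.75] -/
theorem eq_obs_of_path_from_obsPlus :
    ∀ {c : (LogFrobeniusSettingLtimes.logShapePlus (isArc := isArc) v).Vertex}, Path (logShapePlus (isArc := isArc) v).obs c →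
      c = (logShapePlus (isArc := isArc) v).obs := by
  intro c r
  induction r with
  | nil => rfl
  | cons r e ih =>
    rename_i b c
    subst ih
    cases c with
    | base _ => exact (PEmpty.elim e)
    | obs => exact (PEmpty.elim e)

/-- `embMonoPlus` is injective on objects. [cite: MochizukiAbsTopIII2015, Cor 5.10 (iv)(b) p. 148] -/
theorem embMonoPlus_obj_injective : Function.Injective (LogFrobeniusSettingLtimes.embMonoPlus (isArc := isArc) J v).obj := by
  intro a b h
  cases a with
  | base x =>
    cases b with
    | base y =>
      change ExtVertex.base _ = ExtVertex.base _ at h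
      have h0 := ExtVertex.base.inj h
      have h1 : x.1 = y.1 := Subtype.mk.inj h0
      rw [Subtype.ext h1]
    | obs =>
      change ExtVertex.base _ = ExtVertex.base _ at h
      have h0 := ExtVertex.base.inj h
      have h1 : x.1 = .nplus v := Subtype.mk.inj h0
      exact absurd x.2.2 (by rw [h1]; simp [DVertex.row])
  | obs =>
    cases b with
    | base y =>
      change ExtVertex.base _ = ExtVertex.base _ at h
      have h0 := ExtVertex.base.inj h
      have h1 : DVertex.nplus v = y.1 := Subtype.mk.inj h0
      exact absurd y.2.2 (by rw [← h1]; simp [DVertex.row])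
    | obs => rfl

/-- `embMonoPlus` is injective on arrows. [cite: MochizukiAbsTopIII2015, Cor 5.10 (iv)(b) p. 148] -/
theorem embMonoPlus_map_injective {a b : (logShapePlus (isArc := isArc) v).Vertex} :
    Function.Injective ((LogFrobeniusSettingLtimes.embMonoPlus (isArc := isArc) J v).map : (a ⟶ b) → _) := by
  intro e e' h
  cases a with
  | base x =>
    cases b with
    | base y => exact h
    | obs => exact h
  | obs => exact (PEmpty.elim (show PEmpty from by cases b <;> exact e))

/-- `embMonoPlus` is injective on paths. [cite: MochizukiAbsTopIII2015, Cor 5.10 (iv)(b) p. 148] -/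
theorem embMonoPlus_mapPath_injective {a : (logShapePlus (isArc := isArc) v).Vertex} :
    ∀ {b : (logShapePlus (isArc := isArc) v).Vertex} (p q : Path a b),
      (LogFrobeniusSettingLtimes.embMonoPlus (isArc := isArc) J v).mapPath p = (embMonoPlus J v).mapPath q → p = q
  | _, Path.nil, q, h => by
    cases q with
    | nil => rfl
    | cons q e =>
      have hl := congrArg Path.length h
      simp [Prefunctor.mapPath_cons, Path.length_cons] at hl
  | _, Path.cons p e, q, h => by
    cases q with
    | nil =>
      have hl := congrArg Path.length h
      simp [Prefunctor.mapPath_cons, Path.length_cons] at hl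
    | cons q e' =>
      rw [Prefunctor.mapPath_cons, Prefunctor.mapPath_cons] at h
      obtain ⟨hcc, hpq, hee⟩ := Path.cons.inj h
      cases embMonoPlus_obj_injective J v hcc
      cases embMonoPlus_map_injective J v (eq_of_heq hee)
      rw [embMonoPlus_mapPath_injective p q (eq_of_heq hpq)]

/-- **PATH LIFTING for `embMonoPlus`**: every path of `Γ⃗_{D_{An⊢}}` ending at a vertex of `D•_{≤2}` or at `𝒩⊞_v` starts at such
a vertex and is the image of a (unique, by `embMonoPlus_mapPath_injective`) path of `Γ⃗_{D•_{≤2} ∪ {𝒩⊞_v}}` — PROVIDED the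
telecore edges land at non-holomorphic vertices only (`hJ`; true for the printed `φ^{An⊢⊞}_{w,ν} : An⊢ → 𝒩⊢⊞_w`, i.e. for
`J := MonoTelecoreIdx`). [cite: MochizukiAbsTopIII2015, Cor 5.10 (iv)(b) p. 148] -/
theorem exists_eq_embMonoPlus_mapPath (hJ : ∀ a : DSub (monoBase (Vmod := Vmod) (isArc := isArc) 6), a.1.IsHolomorphic →
      IsEmpty (J a))
    {c t : (monoTelecoreShape (Vmod := Vmod) (isArc := isArc) J).Vertex} (r : Path c t) :
    ∀ (x : (logShapePlus (isArc := isArc) v).Vertex), t = (LogFrobeniusSettingLtimes.embMonoPlus J v).obj x →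
      ∃ (y : (logShapePlus (isArc := isArc) v).Vertex) (_ : c = (embMonoPlus J v).obj y)
        (r₀ : Path y x), HEq r ((embMonoPlus J v).mapPath r₀) := by
  induction r with
  | nil => intro x ht; exact ⟨x, ht, Path.nil, by subst ht; rfl⟩
  | cons r e ih =>
    rename_i d t
    intro x ht
    subst ht
    cases x with
    | obs =>
      -- last edge into `𝒩⊞_v`: a `λ⊞_{v,ν}` from `□`, or a telecore edge (excluded by `hJ`)
      cases d with
      | obs => exact ((hJ ⟨.nplus v, monoBase_six_nplus v⟩ trivial).elim e)
      | base z =>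
        obtain ⟨zv, hz⟩ := z
        change DEdge isArc zv (.nplus v) at e
        cases e with
        | lam w ν hν =>
          obtain ⟨y, hc, r₀, hr⟩ := ih ((logShapePlus v).base ⟨.core, core_mem_two⟩) rfl
          refine ⟨y, hc, r₀.cons (lamEdge v ν hν), ?_⟩
          subst hc
          cases eq_of_heq hr
          rfl
    | base xx =>
      obtain ⟨xv, hx⟩ := xx
      cases d with
      | obs => exact ((hJ ⟨xv, monoBase_six_of_inTwo hx⟩ hx.1).elim e)
      | base z =>
        obtain ⟨zv, hz⟩ := z
        -- `e : DEdge zv xv` with `xv` in the first two rows: only `log` and `id_⋎` qualify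
        change DEdge isArc zv xv at e
        cases e with
        | log n =>
          obtain ⟨y, hc, r₀, hr⟩ := ih ((logShapePlus v).base ⟨.row1 (n + 1), row1_mem_two (n + 1)⟩) rfl
          refine ⟨y, hc, r₀.cons (show (logShapePlus (isArc := isArc) v).base ⟨.row1 (n + 1), row1_mem_two (n + 1)⟩ ⟶
            (logShapePlus v).base ⟨.row1 n, hx⟩ from DEdge.log n), ?_⟩
          subst hc
          cases eq_of_heq hr
          rfl
        | toCore n =>
          obtain ⟨y, hc, r₀, hr⟩ := ih ((logShapePlus v).base ⟨.row1 n, row1_mem_two n⟩) rfl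
          refine ⟨y, hc, r₀.cons (show (logShapePlus (isArc := isArc) v).base ⟨.row1 n, row1_mem_two n⟩ ⟶
            (logShapePlus v).base ⟨.core, hx⟩ from DEdge.toCore n), ?_⟩
          subst hc
          cases eq_of_heq hr
          rfl
        | lam w ν hν => exact absurd hx.2 (by simp [DVertex.row])
        | forget w => exact absurd hx.2 (by simp [DVertex.row])
        | toE w => exact absurd hx.2 (by simp [DVertex.row])
        | κAn => exact absurd hx.2 (by simp [DVertex.row])
        | anToE => exact absurd hx.2 (by simp [DVertex.row])
        | monoNplus w => exact absurd hx.1 (by simp [DVertex.IsHolomorphic])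
        | monoN w => exact absurd hx.1 (by simp [DVertex.IsHolomorphic])
        | monoE5 => exact absurd hx.1 (by simp [DVertex.IsHolomorphic])
        | monoAn => exact absurd hx.1 (by simp [DVertex.IsHolomorphic])
        | monoE7 => exact absurd hx.1 (by simp [DVertex.IsHolomorphic])
        | forgetMono w => exact absurd hx.1 (by simp [DVertex.IsHolomorphic])
        | toEmono w => exact absurd hx.1 (by simp [DVertex.IsHolomorphic])
        | κAnMono => exact absurd hx.1 (by simp [DVertex.IsHolomorphic])
        | anMonoToE => exact absurd hx.1 (by simp [DVertex.IsHolomorphic])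

/-- `embMonoPlus` is an EMBEDDING of oriented graphs in the sense of abc-iut-f-101's `GraphEmbedding`
(`DiagramPathEmbeddings.lean`). [cite: MochizukiAbsTopIII2015, Section 0 p.26] -/
theorem graphEmbedding_embMonoPlus : DiagramOfCategories.GraphEmbedding (LogFrobeniusSettingLtimes.embMonoPlus (isArc := isArc) J v) :=
  ⟨embMonoPlus_obj_injective J v, fun {_ _} => embMonoPlus_map_injective J v⟩

/-- `embMonoPlus` is a SIEVE in the sense of abc-iut-f-101's `IsSieve` (every arrow of `Γ⃗_{D_{An⊢}}` INTO `D•_{≤2} ∪ {𝒩⊞_v}`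
comes from it), provided the telecore edges land at non-holomorphic vertices (`hJ`).
[cite: MochizukiAbsTopIII2015, Section 0 p.26] -/
theorem isSieve_embMonoPlus (hJ : ∀ a : DSub (monoBase (Vmod := Vmod) (isArc := isArc) 6), a.1.IsHolomorphic →
      IsEmpty (J a)) : DiagramOfCategories.IsSieve (LogFrobeniusSettingLtimes.embMonoPlus (isArc := isArc) J v) := by
  intro c b' e
  cases b' with
  | obs =>
    cases c with
    | obs => exact ((hJ ⟨.nplus v, monoBase_six_nplus v⟩ trivial).elim e)
    | base z =>
      obtain ⟨zv, hz⟩ := z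
      change DEdge isArc zv (.nplus v) at e
      cases e with
      | lam w ν hν => exact ⟨(logShapePlus v).base ⟨.core, core_mem_two⟩, lamEdge v ν hν, rfl, HEq.rfl⟩
  | base xx =>
    obtain ⟨xv, hx⟩ := xx
    cases c with
    | obs => exact ((hJ ⟨xv, monoBase_six_of_inTwo hx⟩ hx.1).elim e)
    | base z =>
      obtain ⟨zv, hz⟩ := z
      change DEdge isArc zv xv at e
      cases e with
      | log n => exact ⟨(logShapePlus v).base ⟨.row1 (n + 1), row1_mem_two (n + 1)⟩,
          (show (logShapePlus (isArc := isArc) v).base ⟨.row1 (n + 1), row1_mem_two (n + 1)⟩ ⟶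
            (logShapePlus v).base ⟨.row1 n, hx⟩ from DEdge.log n), rfl, HEq.rfl⟩
      | toCore n => exact ⟨(logShapePlus v).base ⟨.row1 n, row1_mem_two n⟩,
          (show (logShapePlus (isArc := isArc) v).base ⟨.row1 n, row1_mem_two n⟩ ⟶
            (logShapePlus v).base ⟨.core, hx⟩ from DEdge.toCore n), rfl, HEq.rfl⟩
      | lam w ν hν => exact absurd hx.2 (by simp [DVertex.row])
      | forget w => exact absurd hx.2 (by simp [DVertex.row])
      | toE w => exact absurd hx.2 (by simp [DVertex.row])
      | κAn => exact absurd hx.2 (by simp [DVertex.row])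
      | anToE => exact absurd hx.2 (by simp [DVertex.row])
      | monoNplus w => exact absurd hx.1 (by simp [DVertex.IsHolomorphic])
      | monoN w => exact absurd hx.1 (by simp [DVertex.IsHolomorphic])
      | monoE5 => exact absurd hx.1 (by simp [DVertex.IsHolomorphic])
      | monoAn => exact absurd hx.1 (by simp [DVertex.IsHolomorphic])
      | monoE7 => exact absurd hx.1 (by simp [DVertex.IsHolomorphic])
      | forgetMono w => exact absurd hx.1 (by simp [DVertex.IsHolomorphic])
      | toEmono w => exact absurd hx.1 (by simp [DVertex.IsHolomorphic])
      | κAnMono => exact absurd hx.1 (by simp [DVertex.IsHolomorphic])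
      | anMonoToE => exact absurd hx.1 (by simp [DVertex.IsHolomorphic])

variable (tel : ∀ {a : DSub (monoBase (Vmod := Vmod) (isArc := isArc) 6)}, J a → (Lt.AnMono ⥤ a.1.categoryLtimes Lt))

/-- The path functors of `D_{An⊢}` along an embedded path are those of the observable's diagram (structural variants, `HEq`
across the definitionally matching vertex categories). [cite: MochizukiAbsTopIII2015, Definition 3.5 (i) pp.74–75] -/
theorem pathFunctor'_embMonoPlus_heq {a : (logShapePlus (isArc := isArc) v).Vertex} :
    ∀ {b : (logShapePlus (isArc := isArc) v).Vertex} (p : Path a b),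
      HEq ((Lt.monoTelecoreDiagram J tel).pathFunctor' ((embMonoPlus J v).mapPath p)) ((Lt.logDiagramPlus v).pathFunctor' p)
  | _, Path.nil => by cases a <;> exact HEq.rfl
  | _, Path.cons (b := b) (c := c) p e => by
    have ih := pathFunctor'_embMonoPlus_heq p
    rw [Prefunctor.mapPath_cons, DiagramOfCategories.pathFunctor'_cons, DiagramOfCategories.pathFunctor'_cons]
    cases b with
    | obs => cases c <;> exact (PEmpty.elim e)
    | base y =>
      cases a with
      | obs =>
        -- no path leaves `𝒩⊞_v` in the observable's graph except the empty one; here `p : obs ⟶ base y`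
        exact absurd (eq_obs_of_path_from_obsPlus v p) (fun h => by cases h)
      | base x =>
        cases c with
        | base z => rw [eq_of_heq ih]; rfl
        | obs => rw [eq_of_heq ih]; rfl

/-- For paths from a vertex of `D•_{≤2}` into `𝒩⊞_v`: an honest equation with the non-structural path functor of the
observable's diagram. [cite: MochizukiAbsTopIII2015, Definition 3.5 (i) pp.74–75] -/
theorem pathFunctor'_embMonoPlus_eq (x : DSub (DVertex.InFirstRows (isArc := isArc) 2))
    (p : Path ((logShapePlus (isArc := isArc) v).base x) (logShapePlus (isArc := isArc) v).obs) :
    (Lt.monoTelecoreDiagram J tel).pathFunctor' ((embMonoPlus J v).mapPath p) = (Lt.logDiagramPlus v).pathFunctor p :=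
  (eq_of_heq (Lt.pathFunctor'_embMonoPlus_heq J v tel p)).trans ((Lt.logDiagramPlus v).pathFunctor_eq_pathFunctor' p).symm

/-- The same with the non-structural path functor of `D_{An⊢}` on the left. [cite: MochizukiAbsTopIII2015, Definition 3.5 (i) pp.74–75] -/
theorem pathFunctor_embMonoPlus_eq (x : DSub (DVertex.InFirstRows (isArc := isArc) 2))
    (p : Path ((logShapePlus (isArc := isArc) v).base x) (logShapePlus (isArc := isArc) v).obs) :
    (Lt.monoTelecoreDiagram J tel).pathFunctor ((embMonoPlus J v).mapPath p) = (Lt.logDiagramPlus v).pathFunctor p :=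
  ((Lt.monoTelecoreDiagram J tel).pathFunctor_eq_pathFunctor' _).trans (Lt.pathFunctor'_embMonoPlus_eq J v tel x p)

end Plus

/-! ## The hypothesis `hJ` for the printed telecore index -/

section ComapAlongPlus

variable (tel : ∀ {a : DSub (monoBase (Vmod := Vmod) (isArc := isArc) 6)}, J a → (Lt.AnMono ⥤ a.1.categoryLtimes Lt))

/-- Vertex categories agree along `embMonoPlus`. [cite: MochizukiAbsTopIII2015, Definition 3.5 (i) p.74] -/
theorem obj_logDiagramPlus_eq_embMonoPlus (a : (logShapePlus (isArc := isArc) v).Vertex) :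
    (Lt.logDiagramPlus v).obj a = (Lt.monoTelecoreDiagram J tel).obj ((embMonoPlus J v).obj a) := by
  cases a <;> rfl

/-- … with the same category structures. [cite: MochizukiAbsTopIII2015, Definition 3.5 (i) p.74] -/
theorem cat_logDiagramPlus_heq_embMonoPlus (a : (logShapePlus (isArc := isArc) v).Vertex) :
    HEq ((Lt.logDiagramPlus v).cat a) ((Lt.monoTelecoreDiagram J tel).cat ((embMonoPlus J v).obj a)) := by
  cases a <;> exact HEq.rfl

/-- Edge functors agree along `embMonoPlus`. [cite: MochizukiAbsTopIII2015, Definition 3.5 (i) p.74] -/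
theorem map_logDiagramPlus_heq_embMonoPlus {a b : (logShapePlus (isArc := isArc) v).Vertex} (e : a ⟶ b) :
    HEq ((Lt.logDiagramPlus v).map e) ((Lt.monoTelecoreDiagram J tel).map ((embMonoPlus J v).map e)) := by
  cases a with
  | base a =>
    cases b with
    | base b => exact HEq.rfl
    | obs => exact HEq.rfl
  | obs =>
    cases b with
    | base b => exact (PEmpty.elim e : False).elim
    | obs => exact (PEmpty.elim e : False).elim

/-- ★ **The observable's diagram (observation vertex `𝒩⊞_v`) IS the telecore diagram `D_{An⊢}` pulled back along `embMonoPlus`**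
(abc-iut-L4-t5's `comapAlong`, via `eq_comapAlong`): the form in which abc-iut-f-101's `DiagramPathEmbeddings` (`LiftPair`,
families on `F^*𝒟`) reads a family of homotopies of the observable inside `D_{An⊢}`.
[cite: MochizukiAbsTopIII2015, Definition 3.5 (i) p.74] -/
theorem logDiagramPlus_eq_comapAlong_embMonoPlus :
    Lt.logDiagramPlus v = (Lt.monoTelecoreDiagram J tel).comapAlong (embMonoPlus J v) :=
  DiagramOfCategories.eq_comapAlong (Lt.monoTelecoreDiagram J tel) (embMonoPlus J v) (Lt.obj_logDiagramPlus_eq_embMonoPlus J v tel)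
    (Lt.cat_logDiagramPlus_heq_embMonoPlus J v tel) (fun e => Lt.map_logDiagramPlus_heq_embMonoPlus J v tel e)

end ComapAlongPlus

end LogFrobeniusSettingLtimes

end Literature.AnabelianGeometry.AbsoluteAnabelian
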